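import Summits.CriticalPhenomena.PercolationContinuityZ3.Theorems.PercNearOneGluingNoHeavyLowerTailSunflowerMultiPetalKempeMarkedUnpaired
import Summits.CriticalPhenomena.PercolationContinuityZ3.Theorems.PercNearOneGluingNoHeavyLowerTailSunflowerMultiPetalKempeMarkedFree
import HarnessLib
import HarnessLib.Audit

/-!
# `NoHeavyLowerTail` (crux stmt-CriticalPhenomena-4575), marked-multigraph layer: THEOREM U′ — the CELLWISE step law at a vertex adjacent to both terminals

Support file (seat `prim-l12-p2` gen 54; `--supports stmt-CriticalPhenomena-4575`; sequel of `…KempeMarkedUnpaired`).  No `sorry`; nothing is asserted about the crux.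
Memo: run/shared/lean/prim/prim-l12/prim-l12-p2/FINDING-g54-UNPAIRED-ALL-D-LAW.md §2.

For an unmarked non-terminal `y` adjacent to BOTH terminals (`mul y u ≠ 0`, `mul y v ≠ 0`, any multiplicities) with `S = N(y) ∖ {u,v}` nonempty, the law
`T(K) ≥ T(K') + ½T(K'/(S∪u → u)) + ½T(K'/(S∪v → v))` holds CELL BY CELL (no pairing, no charging), for every outer degree `|S| ≥ 1`:
* `resB2` (twice the cell residual), `allOneSum`, `sum_resB2_eq`, `resB2_nonneg` (two finite tables and the deficit-profile list), `sum_resB2_nonneg`;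
* `TfunM_peelContract_right`: `T(K.peelContract y S v) = 3^{|S|}·allOneSum` (contracting the monochromatic set `S ∪ {v}` changes no type);
* **`TfunM_step_unpaired_both` (THEOREM U′)**: `2·3^{|S|}·T(K.isolate y) + T(K.peelContract y S u) + T(K.peelContract y S v) ≤ 2·3^{|S|+1}·T(K)`.
Together with THEOREM U (`…UnpairedStep`, `y ≁ v`) this gives an unpaired row-positive law at every `y ∼ u` of outer degree `≥ 2` (memo §2; the transfer to the
fractional-mark hierarchy `TI_{P,Q}` is FINDING-g53 §1).
-/

namespace Summit.CriticalPhenomena.PercolationContinuityZ3.Theorems.SunflowerPartition.Kempe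

open Finset

/-- All-`1` cells of U′: `2·kerTAbs t (a,2,0) − fC t ≥ 0` for `a ≠ 0`. [this work] -/
theorem unpairedBoth_table_all1 : ∀ (t : CType) (a : Fin 3), a ≠ 0 → 0 ≤ 2 * kerTAbs t (a, 2, 0) - fC t := by decide

namespace MGraph

variable {V : Type*} [Fintype V] [LinearOrder V] (K : MGraph V)

section UnpairedBoth

variable (y : V) (S : Finset V)

/-- Twice the cell residual of U′: `2·kerTAbs (type_{K−y} ρ) (profile_y ρ) − [ρ ≡ 0 on S]·fC − [ρ ≡ 1 on S]·fC`. [this work] -/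
def resB2 (ρ : V → Fin 3) : ℤ :=
  2 * kerTAbs ((K.isolate y).ctypeM ρ) (K.profM y ρ)
    - (if ∀ s ∈ S, ρ s = 0 then fC ((K.isolate y).ctypeM ρ) else 0) - (if ∀ s ∈ S, ρ s = 1 then fC ((K.isolate y).ctypeM ρ) else 0)

/-- The all-`1` cell sum `Σ_{ρ u = 0, ρ v = 1} [ρ ≡ 1 on S]·fC (type_{K−y} ρ)` — `3^{|S|}` times this is `T` of `(K−y)/(S∪v → v)` (`TfunM_peelContract_right`). [this work] -/
def allOneSum (u v : V) : ℤ :=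
  ∑ ρ ∈ univ.filter (fun ρ : V → Fin 3 => ρ u = 0 ∧ ρ v = 1), (if ∀ s ∈ S, ρ s = 1 then fC ((K.isolate y).ctypeM ρ) else 0)

/-- `resB2 = 2·resCell + [ρ ≡ 0]·fC − [ρ ≡ 1]·fC`. [this work] -/
theorem resB2_eq (ρ : V → Fin 3) :
    K.resB2 y S ρ = 2 * K.resCell y S ρ + (if ∀ s ∈ S, ρ s = 0 then fC ((K.isolate y).ctypeM ρ) else 0)
      - (if ∀ s ∈ S, ρ s = 1 then fC ((K.isolate y).ctypeM ρ) else 0) := by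
  unfold resB2 resCell; ring

/-- **Cell identity of U′**: `Σ_ρ resB2 = 2·(3·T(K) − T(K.isolate y)) − allZeroSum − allOneSum`. [this work] -/
theorem sum_resB2_eq (u v : ({y}ᶜ : Set V)) :
    ∑ ρ ∈ univ.filter (fun ρ : V → Fin 3 => ρ u.1 = 0 ∧ ρ v.1 = 1), K.resB2 y S ρ
      = 2 * (3 * K.TfunM u.1 v.1 - (K.isolate y).TfunM u.1 v.1) - K.allZeroSum y S u.1 v.1 - K.allOneSum y S u.1 v.1 := by
  rw [sum_congr rfl (fun ρ _ => K.resB2_eq y S ρ)]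
  unfold allOneSum
  rw [sum_sub_distrib, sum_add_distrib, ← mul_sum, K.sum_resCell_eq y S u v]
  unfold allZeroSum
  ring

end UnpairedBoth

section UnpairedBothHeart

variable {K}
variable {u v y : V} {S : Finset V}

/-- **Every cell of U′ is nonnegative** (`y ∼ u`, `y ∼ v`, `y` unmarked, `S ≠ ∅`). [this work] -/
theorem resB2_nonneg (hS : ∀ w, w ∈ S ↔ (w ≠ u ∧ w ≠ v ∧ w ≠ y ∧ K.mul y w ≠ 0)) (huv : u ≠ v) (hyu : y ≠ u) (hyv : y ≠ v)
    (hmy : K.mark y = 0) (hyu' : K.mul y u ≠ 0) (hyv' : K.mul y v ≠ 0) (hne : S.Nonempty) (ρ : V → Fin 3) (hu : ρ u = 0) (hv : ρ v = 1) :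
    0 ≤ K.resB2 y S ρ := by
  obtain ⟨s₁, hs₁⟩ := hne
  have hprof := profM_eq_sums hS huv hyu hyv hmy ρ hu hv
  have hmu : cap3 (K.mul y u) ≠ 0 := fun h => hyu' ((eq_zero_iff_cap3 _).2 h)
  have hmv : cap3 (K.mul y v) ≠ 0 := fun h => hyv' ((eq_zero_iff_cap3 _).2 h)
  set t := (K.isolate y).ctypeM ρ with ht
  set A0 := ∑ s ∈ S, (if ρ s = 0 then K.mul y s else 0) with hA0
  set A1 := ∑ s ∈ S, (if ρ s = 1 then K.mul y s else 0) with hA1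
  set A2 := ∑ s ∈ S, (if ρ s = 2 then K.mul y s else 0) with hA2
  have m1 := Nat.one_le_iff_ne_zero.2 hyu'
  have m2 := Nat.one_le_iff_ne_zero.2 hyv'
  -- a colour present on S makes the corresponding sum positive
  have pos : ∀ c : Fin 3, ∀ s ∈ S, ρ s = c → 1 ≤ ∑ s' ∈ S, (if ρ s' = c then K.mul y s' else 0) := by
    intro c s hs hc
    have hle := single_le_sum (f := fun s' => if ρ s' = c then K.mul y s' else 0) (fun _ _ => Nat.zero_le _) hs
    simp only [hc, if_true] at hle
    exact le_trans (Nat.one_le_iff_ne_zero.2 ((hS s).1 hs).2.2.2) hle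
  by_cases h0 : ∀ s ∈ S, ρ s = 0
  · -- all 0: profile (2, cap (mul y v), 0)
    have h1 : ¬(∀ s ∈ S, ρ s = 1) := fun hh => by have := hh s₁ hs₁; rw [h0 s₁ hs₁] at this; exact absurd this (by decide)
    have hA1z : A1 = 0 := (sumS_eq_zero_iff hS ρ 1).2 fun s hs h => by rw [h0 s hs] at h; exact absurd h (by decide)
    have hA2z : A2 = 0 := (sumS_eq_zero_iff hS ρ 2).2 fun s hs h => by rw [h0 s hs] at h; exact absurd h (by decide)
    have hk : K.profM y ρ = (2, cap3 (K.mul y v), 0) := by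
      rw [hprof, hA1z, hA2z, add_zero, cap3_zero]
      have := pos 0 s₁ hs₁ (h0 s₁ hs₁)
      rw [(two_le_iff_cap3 (K.mul y u + A0)).1 (by omega)]
    unfold resB2; rw [if_pos h0, if_neg h1, hk, ← ht, sub_zero]
    exact unpaired_table_uv t _ hmv
  · by_cases h1 : ∀ s ∈ S, ρ s = 1
    · -- all 1: profile (cap (mul y u), 2, 0)
      have hA0z : A0 = 0 := (sumS_eq_zero_iff hS ρ 0).2 fun s hs h => by rw [h1 s hs] at h; exact absurd h (by decide)
      have hA2z : A2 = 0 := (sumS_eq_zero_iff hS ρ 2).2 fun s hs h => by rw [h1 s hs] at h; exact absurd h (by decide)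
      have hk : K.profM y ρ = (cap3 (K.mul y u), 2, 0) := by
        rw [hprof, hA0z, hA2z, add_zero, cap3_zero]
        have := pos 1 s₁ hs₁ (h1 s₁ hs₁)
        rw [(two_le_iff_cap3 (K.mul y v + A1)).1 (by omega)]
      unfold resB2; rw [if_neg h0, if_pos h1, hk, ← ht, sub_zero]
      exact unpairedBoth_table_all1 t _ hmu
    · -- generic cell: both terminal coordinates positive and not a deficit profile
      unfold resB2; rw [if_neg h0, if_neg h1, sub_zero, sub_zero]
      have hk1 : (K.profM y ρ).1 ≠ 0 := by
        rw [hprof]; intro h; have := (eq_zero_iff_cap3 _).2 h; omega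
      have hk2 : (K.profM y ρ).2.1 ≠ 0 := by
        rw [hprof]; intro h; have := (eq_zero_iff_cap3 _).2 h; omega
      have tri : ∀ z : Fin 3, z = 0 ∨ z = 1 ∨ z = 2 := by decide
      -- not (1,2,0): that needs A0 = 0 and A2 = 0, i.e. all of S coloured 1
      have n120 : K.profM y ρ ≠ (1, 2, 0) := by
        rw [hprof]; intro h
        simp only [Prod.mk.injEq] at h
        have e0 : K.mul y u + A0 = 1 := (eq_one_iff_cap3 _).2 h.1
        have e2 : A2 = 0 := (eq_zero_iff_cap3 _).2 h.2.2
        apply h1; intro s hs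
        rcases tri (ρ s) with hc | hc | hc
        · have := pos 0 s hs hc; omega
        · exact hc
        · have := pos 2 s hs hc; omega
      have n210 : K.profM y ρ ≠ (2, 1, 0) := by
        rw [hprof]; intro h
        simp only [Prod.mk.injEq] at h
        have e1 : K.mul y v + A1 = 1 := (eq_one_iff_cap3 _).2 h.2.1
        have e2 : A2 = 0 := (eq_zero_iff_cap3 _).2 h.2.2
        apply h0; intro s hs
        rcases tri (ρ s) with hc | hc | hc
        · exact hc
        · have := pos 1 s hs hc; omega
        · have := pos 2 s hs hc; omega
      have n110 : K.profM y ρ ≠ (1, 1, 0) := by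
        rw [hprof]; intro h
        simp only [Prod.mk.injEq] at h
        have e0 : K.mul y u + A0 = 1 := (eq_one_iff_cap3 _).2 h.1
        rcases tri (ρ s₁) with hc | hc | hc
        · have := pos 0 s₁ hs₁ hc; omega
        · have e1 : K.mul y v + A1 = 1 := (eq_one_iff_cap3 _).2 h.2.1
          have := pos 1 s₁ hs₁ hc; omega
        · have e2 : A2 = 0 := (eq_zero_iff_cap3 _).2 h.2.2
          have := pos 2 s₁ hs₁ hc; omega
      have n100 : K.profM y ρ ≠ (1, 0, 0) := fun h => hk2 (by rw [h])
      have n101 : K.profM y ρ ≠ (1, 0, 1) := fun h => hk2 (by rw [h])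
      rw [← ht]
      by_contra hlt
      push Not at hlt
      have hneg : kerTAbs t (K.profM y ρ) < 0 := by omega
      rcases kerTAbs_neg_profiles_of_two_le t _ hk1 n100 n101 n110 hneg with h | h | h | h | h
      · exact hk2 (by rw [h])
      · exact n120 h
      · exact hk2 (by rw [h])
      · exact n210 h
      · exact hk2 (by rw [h])

/-- **Heart of U′**: the cell residuals sum to a nonnegative number (every cell is `≥ 0`). [this work] -/
theorem sum_resB2_nonneg (hS : ∀ w, w ∈ S ↔ (w ≠ u ∧ w ≠ v ∧ w ≠ y ∧ K.mul y w ≠ 0)) (huv : u ≠ v) (hyu : y ≠ u) (hyv : y ≠ v)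
    (hmy : K.mark y = 0) (hyu' : K.mul y u ≠ 0) (hyv' : K.mul y v ≠ 0) (hne : S.Nonempty) :
    0 ≤ ∑ ρ ∈ univ.filter (fun ρ : V → Fin 3 => ρ u = 0 ∧ ρ v = 1), K.resB2 y S ρ :=
  sum_nonneg fun ρ hρ => by
    have h := (mem_filter.1 hρ).2
    exact resB2_nonneg hS huv hyu hyv hmy hyu' hyv' hne ρ h.1 h.2

/-- **`T` of the contraction into `v`**: `T(K.peelContract y S v) = 3^{|S|}·allOneSum` (pin the free vertices `S` to the colour of `v`; a monochromatic
contraction changes no type). [this work] -/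
theorem TfunM_peelContract_right (y u v : V) (S : Finset V) (hvy : v ≠ y) (huS : u ∉ S) (hvS : v ∉ S) (hyS : y ∉ S) :
    (K.peelContract y S v).TfunM u v = 3 ^ S.card * K.allOneSum y S u v := by
  set L := K.peelContract y S v with hL
  have hZ : ∀ z ∈ S, L.IsFree z := fun z hz => K.isFree_peelContract_of_mem y v S hz
  have h2 := L.sum_filter_eq_pow_mul fC S hZ (fun σ => σ u = 0 ∧ σ v = 1)
    (fun z hz σ c => by
      have hzu : z ≠ u := fun e => huS (e ▸ hz)
      have hzv : z ≠ v := fun e => hvS (e ▸ hz)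
      rw [Function.update_of_ne hzu.symm, Function.update_of_ne hzv.symm])
    (fun _ _ => 1) (fun _ _ _ _ _ _ => rfl)
  have h3 : ∑ σ ∈ univ.filter (fun σ : V → Fin 3 => (σ u = 0 ∧ σ v = 1) ∧ ∀ z ∈ S, σ z = (1 : Fin 3)), fC (L.ctypeM σ)
      = ∑ σ ∈ univ.filter (fun σ : V → Fin 3 => (σ u = 0 ∧ σ v = 1) ∧ ∀ z ∈ S, σ z = (1 : Fin 3)), fC ((K.isolate y).ctypeM σ) := by
    refine sum_congr rfl fun σ hσ => ?_
    obtain ⟨⟨-, hv⟩, hz⟩ := (mem_filter.1 hσ).2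
    rw [hL, K.ctypeM_peelContract_of_const y v S hvy hvS hyS σ (fun z hz' => by rw [hz z hz', hv])]
  have h4 : ∑ σ ∈ univ.filter (fun σ : V → Fin 3 => (σ u = 0 ∧ σ v = 1) ∧ ∀ z ∈ S, σ z = (1 : Fin 3)), fC ((K.isolate y).ctypeM σ)
      = K.allOneSum y S u v := by
    unfold allOneSum
    rw [sum_filter, sum_filter]
    refine sum_congr rfl fun σ _ => ?_
    by_cases hP : σ u = 0 ∧ σ v = 1
    · by_cases hQ : ∀ z ∈ S, σ z = 1
      · rw [if_pos ⟨hP, hQ⟩, if_pos hP, if_pos hQ]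
      · rw [if_neg (fun h => hQ h.2), if_pos hP, if_neg hQ]
    · rw [if_neg (fun h => hP h.1), if_neg hP]
  unfold TfunM
  rw [h2, h3, h4]

/-- **THEOREM U′ — THE CELLWISE STEP LAW AT A VERTEX ADJACENT TO BOTH TERMINALS, kernel-checked for every outer degree `|S| ≥ 1`** (memo FINDING-g54 §2): for
`u ≠ v`, `y` unmarked with `mul y u ≠ 0` and `mul y v ≠ 0`, `S = N(y) ∖ {u,v} ≠ ∅`:
`2·3^{|S|}·T(K.isolate y) + T(K.peelContract y S u) + T(K.peelContract y S v) ≤ 2·3^{|S|+1}·T(K)`,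
i.e. `T(K−y) + ½T(K'/(S∪u)) + ½T(K'/(S∪v)) ≤ T(K)`, cell by cell. [this work] -/
theorem TfunM_step_unpaired_both (u v y : V) (huv : u ≠ v) (hyu : y ≠ u) (hyv : y ≠ v) (hmark : K.mark y = 0) (hadj : K.mul y u ≠ 0)
    (hadj' : K.mul y v ≠ 0) (S : Finset V) (hS : ∀ w, w ∈ S ↔ (w ≠ u ∧ w ≠ v ∧ w ≠ y ∧ K.mul y w ≠ 0)) (hne : S.Nonempty) :
    2 * 3 ^ S.card * (K.isolate y).TfunM u v + (K.peelContract y S u).TfunM u v + (K.peelContract y S v).TfunM u v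
      ≤ 2 * 3 ^ (S.card + 1) * K.TfunM u v := by
  have huS : u ∉ S := fun h => ((hS u).1 h).1 rfl
  have hvS : v ∉ S := fun h => ((hS v).1 h).2.1 rfl
  have hyS : y ∉ S := fun h => ((hS y).1 h).2.2.1 rfl
  let u' : ({y}ᶜ : Set V) := ⟨u, Set.mem_compl_singleton_iff.mpr hyu.symm⟩
  let v' : ({y}ᶜ : Set V) := ⟨v, Set.mem_compl_singleton_iff.mpr hyv.symm⟩
  have h1 := K.sum_resB2_eq y S u' v'
  have h2 := sum_resB2_nonneg hS huv hyu hyv hmark hadj hadj' hne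
  dsimp only [u', v'] at h1
  rw [h1] at h2
  have hA := K.TfunM_peelContract y u v S hyu.symm huS hyS hvS
  have hB := K.TfunM_peelContract_right y u v S hyv.symm huS hvS hyS
  rw [hA, hB, pow_succ]
  have hp : (0 : ℤ) ≤ 3 ^ S.card := by positivity
  have key : 2 * (K.isolate y).TfunM u v + K.allZeroSum y S u v + K.allOneSum y S u v ≤ 6 * K.TfunM u v := by linarith
  nlinarith [mul_le_mul_of_nonneg_left key hp]

end UnpairedBothHeart

end MGraph

end Summit.CriticalPhenomena.PercolationContinuityZ3.Theorems.SunflowerPartition.Kempe
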